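import Literature.Topology.FourManifolds.Rasmussen
import Literature.Topology.FourManifolds.SliceGenusProofs
import HarnessLib

/-!
# Rasmussen's route to the Milnor conjecture: the assembly step (Rasmussen 2010, §5.2)

Second sibling proof file of `Literature/Topology/FourManifolds/Rasmussen.lean` (next to
`RasmussenProofs.lean`; D-0014: named facts `def X : Prop` are discharged as
`theorem X_holds : X`), devoted to the torus-knot statements.  Everything in this file is
**proved** and no named fact is introduced (D-0026).

The named fact `Literature.Topology.FourManifolds.sliceGenus_torusKnot` of `Rasmussen.lean` —
the **Milnor conjecture** `g₄(T(p,q)) = (p-1)(q-1)/2` for the smooth slice genus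
`Literature.Topology.FourManifolds.Knot.sliceGenus` of the torus knot
`Literature.Topology.FourManifolds.torusKnot p q` (Kronheimer–Mrowka 1993, Cor. 1.3 and the
remark following its proof; Rasmussen 2010, Cor. 1 of §1) — is **not** discharged here: both
halves of it rest on inputs that the tree only has as undischarged named facts (or not at
all).  What this file records, sorry-free, is the *assembly step* of Rasmussen's combinatorial
proof (Rasmussen 2010, §5.2, proof of Thm. 4), which reduces the Milnor conjecture to three
inputs:

1. `Literature.Topology.FourManifolds.abs_le_two_mul_sliceGenus` — Rasmussen's bound
   `|s(K)| ≤ 2 g₄(K)` (Rasmussen 2010, Thm. 1); a named fact of `Rasmussen.lean`, hypothesis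
   `h₁` below;
2. `Literature.Topology.FourManifolds.hasRasmussenInvariant_torusKnot` — `s(T(p,q)) = (p-1)(q-1)`
   (Rasmussen 2010, Thm. 4 via §5.2: a positive diagram with `n` crossings whose oriented
   resolution has `k` circles has `s = n - k + 1`; for the closed positive braid
   `(σ₁ ⋯ σ_{p-1})^q` presenting `T(p,q)`, `n = (p-1)q` and `k = p`); a named fact of
   `Rasmussen.lean`, hypothesis `h₂` below;
3. a spanning surface of genus `(p-1)(q-1)/2` for `T(p,q)`: Seifert's algorithm applied to the
   same positive diagram yields a Seifert surface of Euler characteristic `k - n`, i.e. of genus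
   `(n - k + 1)/2 = (p-1)(q-1)/2` (Rasmussen 2010, §5.2; Seifert 1934), equivalently the Milnor
   fibre of the plane curve singularity `x^p = y^q` has genus `½(p-1)(q-1)` (Kronheimer–Mrowka
   1993, p. 775; Milnor 1968, §1, §10).  The tree has no statement of this classical fact, so
   it enters as an explicit hypothesis `h₃` (in slice-surface or in Seifert-surface form).

Given 1–3 the conclusion is the sandwich of Rasmussen (2010), §5.2, last display —
`2g(K) ≤ 2g(S) = n - k + 1 = s(K) ≤ 2g_*(K)` together with `g_*(K) ≤ g(K)` — specialised to
`(p-1)(q-1) = s(T(p,q)) ≤ 2 g₄(T(p,q)) ≤ 2 ⌊(p-1)(q-1)/2⌋ ≤ (p-1)(q-1)`: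

* `Literature.Topology.FourManifolds.Knot.sliceGenus_eq_of_hasRasmussenInvariant` — the general
  sandwich: given input 1, a knot with `2g ≤ |s(K)|` bounding a slice surface of genus `g` has
  `g₄(K) = g`;
* `Literature.Topology.FourManifolds.sliceGenus_torusKnot_of_hasSliceSurfaceOfGenus` — the
  Milnor conjecture `sliceGenus_torusKnot` from inputs 1, 2 and the slice-surface form of 3;
* `Literature.Topology.FourManifolds.sliceGenus_torusKnot_of_hasSeifertSurfaceOfGenus` — the same
  with input 3 in Seifert-surface form (as Seifert's algorithm delivers it), pushed into `B⁴` by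
  the discharged fact
  `Literature.Topology.FourManifolds.Knot.HasSeifertSurfaceOfGenus.hasSliceSurfaceOfGenus_holds`
  (`SliceGenusProofs.lean`).

The `ℕ`-division needs no parity argument: `N ≤ 2g` and `g ≤ N/2` already force `g = N/2`
(and `N` even).

## References

* J. Rasmussen, *Khovanov homology and the slice genus*, Invent. Math. 182 (2010), 419–447
  (arXiv:math/0402131): §1 Thm. 1 (`|s(K)| ≤ 2g_*(K)`), Thm. 4 (`s(K) = 2g_*(K) = 2g(K)` for
  positive knots), Cor. 1 ("The Milnor Conjecture: the slice genus of the `(p,q)` torus knot is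
  `(p-1)(q-1)/2`"); §5.2 "Positive knots" (`s(K) = -k + n + 1`, Seifert's algorithm, the
  sandwich). [Rasmussen2010]
* P. B. Kronheimer, T. S. Mrowka, *Gauge theory for embedded surfaces, I*, Topology 32 (1993),
  773–826: Cor. 1.3 (p. 774: the algebraic curve realises the slice genus of the knot) and
  p. 775 ("the torus knot `K_{p,q}` … arises from the singular curve `x^p = y^q`, whose Milnor
  fibre has genus `½(p-1)(q-1)`.  This number is therefore the slice genus of the knot").
  [KronheimerMrowka1993]
* H. Seifert, *Über das Geschlecht von Knoten*, Math. Ann. 110 (1934), 571–592 (Seifert's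
  algorithm; genus of torus knots). [Seifert1934]
-/

open scoped Manifold ContDiff Topology
open Function Set

noncomputable section

namespace Literature.Topology.FourManifolds

namespace Knot

/-- **Rasmussen's sandwich** (the mechanism of Rasmussen 2010, Thm. 4 and Cor. 1): granted the
bound `|s(K)| ≤ 2 g₄(K)` (named fact `abs_le_two_mul_sliceGenus`, hypothesis `h₁`), a knot `K`
with Rasmussen invariant `s`, `2g ≤ |s|`, which bounds a slice surface of genus `g`, has slice
genus exactly `g`: `2g ≤ |s| ≤ 2 g₄(K) ≤ 2g`.
Rasmussen (2010), §5.2, last display and the sentence following it. [cite: Rasmussen2010, §5.2] -/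
theorem sliceGenus_eq_of_hasRasmussenInvariant (h₁ : abs_le_two_mul_sliceGenus) {K : Knot}
    {s : ℤ} {g : ℕ} (hs : K.HasRasmussenInvariant s) (hg : 2 * (g : ℤ) ≤ |s|)
    (hS : K.HasSliceSurfaceOfGenus g) : K.sliceGenus = g := by
  refine le_antisymm (sliceGenus_le_of_hasSliceSurfaceOfGenus hS) ?_
  have h : 2 * (g : ℤ) ≤ 2 * (K.sliceGenus : ℤ) := hg.trans (h₁ hs)
  exact_mod_cast Int.le_of_mul_le_mul_left h two_pos

end Knot

variable [TorusKnotFacts]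

/-- **The Milnor conjecture, assembled along Rasmussen's route (slice-surface form).**  Granted
(1) Rasmussen's bound `|s(K)| ≤ 2 g₄(K)` (named fact `abs_le_two_mul_sliceGenus`, `h₁`),
(2) the value `s(T(p,q)) = (p-1)(q-1)` (named fact `hasRasmussenInvariant_torusKnot`, `h₂`), and
(3) a slice surface of genus `(p-1)(q-1)/2` for every torus knot `T(p,q)`, `p, q ≥ 2` coprime
(`h₃`; classically Seifert's surface of the positive braid diagram pushed into `B⁴`, or the
Milnor fibre of `x^p = y^q`), the slice genus of `T(p,q)` is `(p-1)(q-1)/2`, i.e. the named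
fact `sliceGenus_torusKnot` holds: `(p-1)(q-1) = s ≤ 2 g₄ ≤ 2 ⌊(p-1)(q-1)/2⌋ ≤ (p-1)(q-1)`.
Rasmussen (2010), §1 Cor. 1 and §5.2 (proof of Thm. 4); Kronheimer–Mrowka (1993), Cor. 1.3
and p. 775. [cite: Rasmussen2010, §5.2] -/
theorem sliceGenus_torusKnot_of_hasSliceSurfaceOfGenus (h₁ : abs_le_two_mul_sliceGenus)
    (h₂ : hasRasmussenInvariant_torusKnot)
    (h₃ : ∀ (p q : ℕ) (hp : 2 ≤ p) (hq : 2 ≤ q) (h : p.Coprime q),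
      (torusKnot p q hp hq h).HasSliceSurfaceOfGenus ((p - 1) * (q - 1) / 2)) :
    sliceGenus_torusKnot := by
  intro p q hp hq h
  have hle : (torusKnot p q hp hq h).sliceGenus ≤ (p - 1) * (q - 1) / 2 :=
    Knot.sliceGenus_le_of_hasSliceSurfaceOfGenus (h₃ p q hp hq h)
  have hs : |((p : ℤ) - 1) * ((q : ℤ) - 1)| ≤ 2 * ((torusKnot p q hp hq h).sliceGenus : ℤ) :=
    h₁ (h₂ p q hp hq h)
  have e : (((p - 1) * (q - 1) : ℕ) : ℤ) = ((p : ℤ) - 1) * ((q : ℤ) - 1) := by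
    have e₁ : ((p - 1 : ℕ) : ℤ) = (p : ℤ) - 1 := by omega
    have e₂ : ((q - 1 : ℕ) : ℤ) = (q : ℤ) - 1 := by omega
    rw [Nat.cast_mul, e₁, e₂]
  have hge : (p - 1) * (q - 1) ≤ 2 * (torusKnot p q hp hq h).sliceGenus := by
    have : (((p - 1) * (q - 1) : ℕ) : ℤ) ≤ 2 * ((torusKnot p q hp hq h).sliceGenus : ℤ) := by
      rw [e]
      exact (le_abs_self _).trans hs
    exact_mod_cast this
  generalize (p - 1) * (q - 1) = N at hle hge ⊢
  omega

/-- **The Milnor conjecture, assembled along Rasmussen's route (Seifert-surface form).**  As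
`sliceGenus_torusKnot_of_hasSliceSurfaceOfGenus`, with input (3) in the form Seifert's
algorithm delivers it — a Seifert surface of genus `(p-1)(q-1)/2` for `T(p,q)` in `𝕊³`
(Euler characteristic `k - n = p - (p-1)q`, Rasmussen 2010, §5.2; Seifert 1934) — pushed into
the 4-ball by the discharged fact `Knot.HasSeifertSurfaceOfGenus.hasSliceSurfaceOfGenus_holds`
(`g₄ ≤ g`).  Rasmussen (2010), §5.2 (proof of Thm. 4) and §1 Cor. 1. [cite: Rasmussen2010, §5.2] -/
theorem sliceGenus_torusKnot_of_hasSeifertSurfaceOfGenus (h₁ : abs_le_two_mul_sliceGenus)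
    (h₂ : hasRasmussenInvariant_torusKnot)
    (h₃ : ∀ (p q : ℕ) (hp : 2 ≤ p) (hq : 2 ≤ q) (h : p.Coprime q),
      (torusKnot p q hp hq h).HasSeifertSurfaceOfGenus ((p - 1) * (q - 1) / 2)) :
    sliceGenus_torusKnot :=
  sliceGenus_torusKnot_of_hasSliceSurfaceOfGenus h₁ h₂ fun p q hp hq h ↦
    Knot.HasSeifertSurfaceOfGenus.hasSliceSurfaceOfGenus_holds (h₃ p q hp hq h)

end Literature.Topology.FourManifolds
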